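import Literature.Topology.FourManifolds.GaussDiagrams
import Literature.Topology.FourManifolds.GaussDiagramsRMoves
import HarnessLib

/-!
# DESIGN SKETCH (crux workfile, not a proposal): link Gauss diagrams for the cobordism debt of `ZseThesis`

Crux stmt-SmoothPoincare4-0364 (`ZeroSurgeryExotic.ZseThesis`), line `Sketch`, skeleton v3: the stub
`stub_sliceHasZero : ∀ K, K.IsSmoothlySlice → K.HasRasmussenInvariant 0` (Rasmussen 2010 Thm 1 with a free
representative) is blocked on DEFINITIONS the tree does not have: multi-component (link) Gauss diagrams and
their Khovanov/Lee cube (census items D1/D2 of lead c3, NOTES.md / evidence CENSUS-waves-c3.md). This file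
records, kernel-checked at the level of signatures, the minimal design the lead recommends to the definition
seats. It introduces declarations ONLY inside the crux namespace (a workfile; nothing here is cited by the
skeleton) and proves a few sanity lemmas; it is meant to be copied into `Literature/Topology/FourManifolds/`
by a definition seat, not imported.

Design (after the wave-2 census): a link diagram is a knot-style Gauss diagram — `n` chords on `2n` marked
points with over/under/sign data — together with

* a TRAVERSAL SUCCESSOR `next : Equiv.Perm (Fin (2 * n))`, whose cycles are the components met by chords
  (for a knot diagram `next = finRotate (2 * n)`, i.e. `p ↦ p + 1`), and
* a number `free` of chord-free round components (needed for births/deaths: the unknot at the end of a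
  movie is `n = 0, free = 1`).

Arcs are "the arc leaving a marked point" plus the free circles; the arc entering `p` is the arc leaving
`next⁻¹ p`; the reconnection relation of a state, state circles, enhanced states, the Khovanov / Frobenius /
Lee differentials and `qMin` are then VERBATIM those of `KhResolutions` / `KhComplex` / `LeeRasmussen` with
`p + 1` replaced by `next p` — so that on `ofGaussDiagram G` everything agrees definitionally with the knot
tower. The elementary Morse moves are purely combinatorial: `birth`/`death` change `free` by one, and a
SADDLE along the arcs leaving two marked points `p ≠ q` is `next ↦ next * swap p q` (it reconnects
`p → next q`, `q → next p`; it merges two components or splits one according to whether `p, q` lie on one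
cycle of `next`). Reidemeister moves need `insertChord` with an update of `next` (not sketched).

References: GPV (2000) §1 (Gauss diagrams of links); Rasmussen (2010) §4.1 (elementary cobordisms);
Bar-Natan (2005) §8 (movies). Lead c3, 2026-08-17.
-/

noncomputable section

-- the prescribed namespace `Summit.<P>.<Sub>.…` duplicates `SmoothPoincare4` (P = Sub)
set_option linter.dupNamespace false

open Function

namespace Summit.SmoothPoincare4.SmoothPoincare4.Cruxes.ZseThesis.Design

open Literature.Topology.FourManifolds

/-- **(D1) A Gauss diagram of an oriented link**: `n` chords on `2n` marked points (`overPos`, `underPos`,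
`sign`, `bijective` exactly as in `GaussDiagram`), a traversal successor `next` (one cycle per component
met by chords) and a number `free` of chord-free components. GPV (2000), §1. -/
structure LinkGaussDiagram where
  /-- The number of chords (crossings). -/
  n : ℕ
  /-- The number of chord-free (round) components. -/
  free : ℕ
  /-- The position of the over-passage of crossing `i`. -/
  overPos : Fin n → Fin (2 * n)
  /-- The position of the under-passage of crossing `i`. -/
  underPos : Fin n → Fin (2 * n)
  /-- The sign of crossing `i`. -/
  sign : Fin n → ℤˣ
  /-- Every marked point is an endpoint of exactly one chord. -/
  bijective : Bijective (Sum.elim overPos underPos)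
  /-- The traversal successor of a marked point along the orientation of its component. -/
  next : Equiv.Perm (Fin (2 * n))

namespace LinkGaussDiagram

variable (L : LinkGaussDiagram)

/-- **The knot tower embeds**: a knot Gauss diagram is a link Gauss diagram with successor `p ↦ p + 1` and
no free component. -/
def ofGaussDiagram (G : GaussDiagram) : LinkGaussDiagram where
  n := G.n
  free := 0
  overPos := G.overPos
  underPos := G.underPos
  sign := G.sign
  bijective := G.bijective
  next := finRotate (2 * G.n)

/-- The embedding preserves the number of chords. -/
@[simp] theorem ofGaussDiagram_n (G : GaussDiagram) : (ofGaussDiagram G).n = G.n := rfl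

/-- The embedding is injective (a knot diagram is recovered from its image). -/
theorem ofGaussDiagram_injective : Injective ofGaussDiagram := by
  intro G G' h
  have hn : G.n = G'.n := congrArg LinkGaussDiagram.n h
  obtain ⟨n, o, u, s, b⟩ := G
  obtain ⟨n', o', u', s', b'⟩ := G'
  cases hn
  simp only [ofGaussDiagram, LinkGaussDiagram.mk.injEq, heq_eq_eq, true_and, and_true] at h
  obtain ⟨rfl, rfl, rfl⟩ := h
  rfl

/-- The round unknot(s): no chord, `k` free circles (`k = 1` is the crossingless unknot diagram at the end
of a movie of a slice disc; `k = 0` corresponds to `GaussDiagram.empty` read as a link diagram). -/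
def unknots (k : ℕ) : LinkGaussDiagram where
  n := 0
  free := k
  overPos := Fin.elim0
  underPos := Fin.elim0
  sign := Fin.elim0
  bijective := ⟨fun a ↦ by rcases a with a | a <;> exact a.elim0, fun b ↦ b.elim0⟩
  next := 1

/-- The image of the empty knot diagram is `unknots 0` (NOT `unknots 1`: the knot tower's `GaussDiagram.empty`
has one arc, `arcCount = max (2n) 1`, a convention the link tower must reproduce on `ofGaussDiagram` — flagged
for the definition seat). -/
theorem ofGaussDiagram_empty : ofGaussDiagram GaussDiagram.empty = unknots 0 := by
  simp only [ofGaussDiagram, unknots, LinkGaussDiagram.mk.injEq, GaussDiagram.empty, heq_eq_eq, true_and]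
  exact Equiv.ext fun a ↦ a.elim0

/-- **(D2, arcs)** The arcs of a link diagram: the arc leaving each marked point, and the free circles. -/
abbrev Arc : Type := Fin (2 * L.n) ⊕ Fin L.free

/-- The arc leaving the marked point `p`. -/
def arcOut (p : Fin (2 * L.n)) : L.Arc := .inl p

/-- The arc entering the marked point `p`: the arc leaving its traversal predecessor. -/
def arcIn (p : Fin (2 * L.n)) : L.Arc := .inl (L.next.symm p)

/-- On a knot diagram the arc entering `p` leaves `p - 1 (mod 2n)`, as in `GaussDiagram.arcIn`. -/
theorem arcIn_ofGaussDiagram (G : GaussDiagram) (p : Fin (2 * G.n)) :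
    (ofGaussDiagram G).arcIn p = .inl ((finRotate (2 * G.n)).symm p) := rfl

-- Two marked points lie on the same component iff `L.next.SameCycle p q` (Mathlib's `Equiv.Perm.SameCycle`).

/-- **(T4, combinatorial level) Birth** of a chord-free circle. Rasmussen (2010), §4.1. -/
def birth : LinkGaussDiagram := { L with free := L.free + 1 }

/-- **Death** of a chord-free circle (meaningful when `0 < free`). Rasmussen (2010), §4.1. -/
def death : LinkGaussDiagram := { L with free := L.free - 1 }

/-- **Saddle** (oriented band) between the arcs leaving two marked points `p ≠ q`: the successor becomes
`next * swap p q`, i.e. `p ↦ next q`, `q ↦ next p`, all other successors unchanged; it merges the components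
of `p` and `q` if they differ and splits their common component otherwise. (Saddles involving a free circle:
merging a free circle into an arc is `death`-shaped on `free` with `next` unchanged; splitting a chord-free
circle off one arc is `birth`-shaped.) Rasmussen (2010), §4.1, Fig. 6. -/
def saddle (p q : Fin (2 * L.n)) : LinkGaussDiagram := { L with next := L.next * Equiv.swap p q }

/-- The saddle reconnects `p` to the old successor of `q`. -/
theorem saddle_next_left (p q : Fin (2 * L.n)) : (L.saddle p q).next p = L.next q := by
  show (L.next * Equiv.swap p q) p = L.next q
  rw [Equiv.Perm.mul_apply, Equiv.swap_apply_left]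

/-- The saddle reconnects `q` to the old successor of `p`. -/
theorem saddle_next_right (p q : Fin (2 * L.n)) : (L.saddle p q).next q = L.next p := by
  show (L.next * Equiv.swap p q) q = L.next p
  rw [Equiv.Perm.mul_apply, Equiv.swap_apply_right]

/-- The saddle changes no other successor. -/
theorem saddle_next_of_ne {p q r : Fin (2 * L.n)} (hp : r ≠ p) (hq : r ≠ q) :
    (L.saddle p q).next r = L.next r := by
  show (L.next * Equiv.swap p q) r = L.next r
  rw [Equiv.Perm.mul_apply, Equiv.swap_apply_of_ne_of_ne hp hq]

/-- A saddle is an involution on the successor data (the same band read backwards). -/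
theorem saddle_saddle (p q : Fin (2 * L.n)) : (L.saddle p q).saddle p q = L := by
  obtain ⟨n, f, o, u, s, b, nx⟩ := L
  show (⟨n, f, o, u, s, b, nx * Equiv.swap p q * Equiv.swap p q⟩ : LinkGaussDiagram) = ⟨n, f, o, u, s, b, nx⟩
  rw [mul_assoc, Equiv.swap_mul_self, mul_one]

/-!
### What the definition seat still has to supply (signatures only, see the census)

* the cube: `State := Fin n → Bool`, the reconnection relation on `Arc` (Seifert / non-Seifert gluing at the two
  ends of each chord, with `arcIn` as above), `StateCircle`, `EnhancedState`, `khovanovD`, `frobeniusHomology`,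
  `leeCycles`, `LeeHomologyZero`, `qMin`, all agreeing with the knot tower on `ofGaussDiagram`;
* realisability `Link.HasGaussDiagram (L : Link ι) (D : LinkGaussDiagram)` through a regular projection of
  a link (the knot case is `Knot.RegularProjection`), and Gauss's parity / merge-or-split for realisable link
  diagrams (`d² = 0`);
* `insertChord`-type Reidemeister moves updating `next`, and the chain maps of `birth` (`x ↦ x ⊗ 1`), `death`
  (`1 ↦ 0, X ↦ 1` — Rasmussen's `ε`), `saddle` (merge `m` / split `Δ` entries, `KhFaces`), filtered of degree
  `+1, +1, -1`; Rasmussen Prop 4.1 for each; the movie presentation of `Knot.IsSliceDisc` (rigid form, no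
  Reidemeister events: census CENSUS-stub_sliceHasZero items 2–3).
-/

end LinkGaussDiagram

end Summit.SmoothPoincare4.SmoothPoincare4.Cruxes.ZseThesis.Design

end
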